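import Summits.QuantumFields.YangMills.Theorems.BalabanUVNodesPortS1SmallLetter
import Summits.QuantumFields.YangMills.Theorems.BalabanUVNodesPortS1FlatVk
import Summits.QuantumFields.YangMills.Theorems.BalabanUVNodesN07CritCfgAxOfRecordClauses

/-!
# NODE O port PT-A — THE LETTERS OF THE LZ (63)-ALGEBRA ALONG THE RECORD's BACKGROUND PATH `B ↦ V^{(k)}_{ax}(W_B) = portVkAx F a₀ ε₂₉ k K B`, EVENTUALLY NEAR `B = 0`,
# FROM THE TWO TOKEN SHAPES OF ⁸ (TokE: `PlaqSmall ε₁ V → UkExists ∧ UniqueUkOrbit` at radius `a₀`; TokP9-reg: analyticity of `B ↦ U_{k+1}(W_B)` at `0`): eventually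
# `PlaqSmall t (V_B)` (every `t > 0`), every (0.4) loop variable within `α` of `1` (every `α > 0`), the guard at every coarse bond, ★★★ THE LETTER
# `RecordB0BlockInvertible F k K (V_B)`, and the Z-bridge `recordZkkCan = recordZkkLoc` with ONLY `PosDef recordPreckLoc` displayed

Cell `ym-nodeO-ideate`, porter seat `ymgap-nodeO-port-PTA-1` (gen 5); `--supports stmt-QuantumFields-27930` (helper; completes PORT-PLAN-v4 §6 on the germ at `B = 0`: the `hsmall`∕`hA`
hypotheses of `recordLQt_mem_lieSU_of_small` ✓p811152, `recordZkkCan_eq_recordZkkLoc_of_small` ✓p811152, `phiLZ_eq_logDet_sum₀` ✓p811030, `phiLZ_eq_resolvent` ✓p810202 discharged along the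
path from ⁸'s own antecedent shapes).  [I] = [Balaban1987RG1], [15] = [Balaban1985Variational], [B7] = [Balaban1985Averaging].
CONSUMED BY NAME, nothing modified: this lineage's `recordB0BlockInvertible_of_loopSmall` (✓p811778), `eventually_isBackground_recordBgField_of_tokE` ∕ `continuousAt_recordBgField_of_analyticAt`
∕ `recordBgField_zero` (✓p798206 `…PortS1Selector`), `portVkAx` (✓p808653), `recordZkkCan_eq_recordZkkLoc_of_small` (✓p811152); NODE 00's `critCfgAxOfRecord_eq_of_isBackground`
(choice-freeness on the uniqueness set), `B15Claim189UnitTestAtRecord.iter_avOfRecord_one`, `isOpen_plaqSmall`, `B15Chi124DetSets.plaqHol_one`; N07's `N07DirectMethod.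
continuousAt_iter_avOfRecord_of_plaqSmall` (Prop. 2 road) and `N07CritCfgAxOfRecordClauses.plaqSmall_axialize_iff`; `LatticeWordStokes.dist1_loopHol_le`.

THE ARGUMENT.  On the TokE germ, `W_B` is small-field, `U_{k+1}(W_B) = recordBgField B` is a genuine minimiser and the minimal orbit is unique, so the block-axial letter is
`V_B = axialize (Ū^k (recordBgField B))` (★ `eventually_portVkAx_eq_axialize_iter`).  `PlaqSmall` is gauge invariant, hence blind to `axialize`; `B ↦ Ū^k(recordBgField B)` is
continuous at `0` (TokP9-reg ⇒ continuity of the rooted background; `Ū^k` continuous at `1` by N07's direct-method road, ★ `continuousAt_iter_avOfRecord_one`) with value `Ū^k(1) = 1`;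
so every strict plaquette inequality persists near `0` (★★ `eventually_plaqSmall_portVkAx`), hence every loop-variable bound (★★ `eventually_loopSmall_portVkAx`), the guard (★★
`eventually_small_portVkAx`), the letter (★★★ `eventually_recordB0BlockInvertible_portVkAx`, via ✓p811778 at `α := min(1∕24, L^{1−d}∕314)`), and the Z-bridge with positivity alone displayed
(★★ `eventually_recordZkkCan_eq_recordZkkLoc_portVkAx`).

HONEST FRAMING.  Topology ∕ bookkeeping over the tree's own theorems; the two token SHAPES are HYPOTHESES of every theorem here (they are conjuncts of ⁸'s antecedent, not
discharged); NOTHING of Bałaban's estimates asserted, ported or discharged; (β) positivity ∕ (E2) and (α) P0 stay DISPLAYED in `stub_LZ`; 27930 OPEN · no claim; K0⁷∕K-Ax OPEN; NODE O 0∕1;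
COUNT 8∕28 · K 1∕4 UNMOVED; finite `𝕋⁴_{L^K}` at fixed ε — NOT continuum ∕ OS ∕ Clay; **the Yang–Mills mass gap is NOT proved by any of this.**  No `sorry`, no `def`, no `instance`, no
`notation`; standard axioms.
-/

noncomputable section

open scoped BigOperators Matrix.Norms.L2Operator Topology

namespace Summit.QuantumFields.YangMills.Theorems.BalabanUVNodesPortS1

open Summit.QuantumFields.YangMills.Theorems.K0RecordFormatNames
open Summit.QuantumFields.YangMills.BalabanUVNodes
open Literature.MathematicalPhysics.QuantumFieldTheory.Balaban1983to89
open Literature.MathematicalPhysics.QuantumFieldTheory.Balaban1983to89.Node00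
open Literature.MathematicalPhysics.QuantumFieldTheory.Balaban1983to89.T4Continuum (T4Family)
open Literature.MathematicalPhysics.QuantumFieldTheory.Balaban1983to89.BlockAveraging (avgFun loopHol Small Idx)
open Literature.MathematicalPhysics.QuantumFieldTheory.Balaban1983to89.ExpMeanLog (expMeanLogSU deltaSU)
open Literature.MathematicalPhysics.QuantumFieldTheory.Balaban1983to89.BlockAxialRepresentative (axialize)
open _root_.Matrix _root_.Filter

variable (F : T4Family)

/-! ## §1  The `k`-fold average of record is continuous at the unit configuration -/

/-- **`U ↦ Ū^k(U)` is continuous at `U = 1`** (N07's `continuousAt_iter_avOfRecord_of_plaqSmall` at the unit configuration, which is (52)-small for every admissible `α₀`; an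
admissible `α₀ > 0` exists). [cite: Balaban1985Averaging, Prop. 2 (52)–(54) p.26; Balaban1987RG1, (0.4) p.253] -/
theorem continuousAt_iter_avOfRecord_one (K k : ℕ) :
    ContinuousAt (Averaging.iter (avOfRecord F 2 K) k) (1 : GaugeField (F.P K) 0 (SU 2)) := by
  -- an admissible `α₀`
  set C : ℝ := 143 * (((((F.P K).d + 4 : ℕ) : ℝ)) ^ 2 / 4) ^ 2 with hC
  set D : ℝ := ((((F.P K).d + 4) * (F.P K).L : ℕ) : ℝ) ^ 2 with hD
  have hCpos : 0 < C := by
    have : (0 : ℝ) < ((((F.P K).d + 4 : ℕ) : ℝ)) := by positivity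
    positivity
  have hDpos : 0 < D := by
    have hL : (0 : ℝ) < (((F.P K).d + 4) * (F.P K).L : ℕ) := by
      have := (F.P K).L_pos
      positivity
    positivity
  have hδ := ExpMeanLog.deltaSU_pos (n := Fin 2)
  set α₀ : ℝ := min (1 / (3 * C)) (deltaSU (Fin 2) / D) with hα₀
  have hα : 0 < α₀ := lt_min (by positivity) (by positivity)
  have hα3 : C * α₀ ≤ 1 / 3 := by
    have h1 : α₀ ≤ 1 / (3 * C) := min_le_left _ _
    calc C * α₀ ≤ C * (1 / (3 * C)) := by gcongr
      _ = 1 / 3 := by field_simp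
  have hα2 : 2 * α₀ ≤ 2 * deltaSU (Fin 2) / D := by
    have h1 : α₀ ≤ deltaSU (Fin 2) / D := min_le_right _ _
    rw [mul_div_assoc]
    linarith
  have h52 : PlaqSmall (α₀ * (F.P K).eta k ^ 2) (1 : GaugeField (F.P K) 0 (SU 2)) := by
    intro p
    rw [B15Chi124DetSets.plaqHol_one, GaugeGroup.dist1_one]
    have hη : 0 < (F.P K).eta k := by
      have hL : (0 : ℝ) < (F.P K).L := by exact_mod_cast (F.P K).L_pos
      unfold Params.eta
      positivity
    positivity
  exact N07DirectMethod.continuousAt_iter_avOfRecord_of_plaqSmall (N := 2) K k hα hα3 hα2 h52 k le_rfl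

/-! ## §2  Along the record's path `B ↦ V^{(k)}_{ax}(W_B)`: the representation through the rooted background, and smallness near `B = 0` -/

/-- The cut-off radius of the record's fill is `a₀`: `(thetaFill F a₀ ε₂₉).ν.εreg = a₀` (`rfl`). [cite: Balaban1987RG1, (1.2) p.260 (bookkeeping)] -/
theorem thetaFill_εreg (a₀ ε₂₉ : ℝ) : (thetaFill F a₀ ε₂₉).ν.εreg = a₀ := rfl

/-- ★ **UNDER TokE, NEAR `B = 0`: `V^{(k)}_{ax}(W_B) = axialize (Ū^k (U_{k+1}(W_B)))`** — the block-axial critical configuration is the axialised `k`-fold average of the ROOTED background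
`recordBgField B` (choice-freeness on the uniqueness set, `critCfgAxOfRecord_eq_of_isBackground`; the minimiser property and uniqueness eventually from the TokE shape,
`eventually_isBackground_recordBgField_of_tokE`). [cite: Balaban1987RG1, (2.2)–(2.3) p.265; Balaban1985Variational, Thm 1 p.279] -/
theorem eventually_portVkAx_eq_axialize_iter (a₀ ε₂₉ : ℝ) {k K : ℕ} (hk : k + 1 ≤ (F.P K).m + (F.P K).K) {ε₁ : ℝ} (hε₁ : 0 < ε₁)
    (hTokE : ∀ V : GaugeField (F.P K) (k + 1) (SU 2), PlaqSmall ε₁ V → UkExists F 2 K (k + 1) a₀ V ∧ UniqueUkOrbit F 2 K (k + 1) a₀ V) :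
    letI θ := thetaFill F a₀ ε₂₉; letI := θ.instVβ₁; letI := θ.instVβ₂
    ∀ᶠ B in 𝓝 (0 : recordW F a₀ ε₂₉ k K),
      portVkAx F a₀ ε₂₉ k K B = axialize (contourOfRecord F 2 K k) (Averaging.iter (avOfRecord F 2 K) k (recordBgField F θ k K B)) := by
  letI θ := thetaFill F a₀ ε₂₉; letI := θ.instVβ₁; letI := θ.instVβ₂
  filter_upwards [eventually_isBackground_recordBgField_of_tokE F a₀ ε₂₉ hk hε₁ hTokE] with B hB
  rw [portVkAx]
  exact critCfgAxOfRecord_eq_of_isBackground (ν := θ.ν) (by omega) hB.2 hB.1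

/-- **`B ↦ Ū^k(U_{k+1}(W_B))` IS CONTINUOUS AT `B = 0`** from the TokP9-reg shape (continuity of the rooted background at `0`, `U_{k+1}(W_0) = 1`, and §1).
[cite: Balaban1985Variational, Prop. 9 p.309; Balaban1987RG1, (2.3) p.265, (0.4) p.253] -/
theorem continuousAt_iter_recordBgField (θ : Stage13Params F 2) {k K : ℕ} (hk : k + 1 ≤ (F.P K).m + (F.P K).K)
    (hP9 : letI := θ.instVβ₁; letI := θ.instVβ₂
      AnalyticAt ℝ (fun B : Fin (F.P K).d → Site (F.P K) (k + 1) → θ.Vβ => fun (b : PBond (F.P K) 0) (i i' : Fin 2) =>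
        ((recordBgField F θ k K B b : SU 2) : Matrix (Fin 2) (Fin 2) ℂ) i i') 0) :
    letI := θ.instVβ₁; letI := θ.instVβ₂
    ContinuousAt (fun B : Fin (F.P K).d → Site (F.P K) (k + 1) → θ.Vβ => Averaging.iter (avOfRecord F 2 K) k (recordBgField F θ k K B)) 0 := by
  letI := θ.instVβ₁; letI := θ.instVβ₂
  have hbg : ContinuousAt (fun B : Fin (F.P K).d → Site (F.P K) (k + 1) → θ.Vβ => recordBgField F θ k K B) 0 := by
    refine continuousAt_pi.2 fun b => ?_
    exact (Topology.IsInducing.subtypeVal.continuousAt_iff).2 (continuousAt_recordBgField_of_analyticAt F θ k K hP9 b)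
  have h0 : recordBgField F θ k K (0 : Fin (F.P K).d → Site (F.P K) (k + 1) → θ.Vβ) = 1 := recordBgField_zero F θ hk
  have hit : ContinuousAt (Averaging.iter (avOfRecord F 2 K) k)
      ((fun B : Fin (F.P K).d → Site (F.P K) (k + 1) → θ.Vβ => recordBgField F θ k K B) 0) := by
    have e : (fun B : Fin (F.P K).d → Site (F.P K) (k + 1) → θ.Vβ => recordBgField F θ k K B) 0 = 1 := h0
    rw [e]
    exact continuousAt_iter_avOfRecord_one F K k
  exact hit.comp hbg

/-- ★★ **NEAR `B = 0` THE RECORD's BACKGROUND `V^{(k)}_{ax}(W_B)` HAS SMALL PLAQUETTES**: under the TokE and TokP9-reg shapes, for every `t > 0`, eventually `PlaqSmall t (portVkAx … B)`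
(`PlaqSmall` is gauge invariant, so it passes through `axialize`; `Ū^k(U_{k+1}(W_B)) → Ū^k(1) = 1`; finitely many strict inequalities).
[cite: Balaban1987RG1, (2.3) p.265, (1.2) p.260; Balaban1985Variational, Thm 1 p.279, Prop. 9 p.309] -/
theorem eventually_plaqSmall_portVkAx (a₀ ε₂₉ : ℝ) {k K : ℕ} (hk : k + 1 ≤ (F.P K).m + (F.P K).K) {ε₁ : ℝ} (hε₁ : 0 < ε₁)
    (hTokE : ∀ V : GaugeField (F.P K) (k + 1) (SU 2), PlaqSmall ε₁ V → UkExists F 2 K (k + 1) a₀ V ∧ UniqueUkOrbit F 2 K (k + 1) a₀ V)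
    (hP9 : letI θ := thetaFill F a₀ ε₂₉; letI := θ.instVβ₁; letI := θ.instVβ₂
      AnalyticAt ℝ (fun B : recordW F a₀ ε₂₉ k K => fun (b : PBond (F.P K) 0) (i i' : Fin 2) =>
        ((recordBgField F θ k K B b : SU 2) : Matrix (Fin 2) (Fin 2) ℂ) i i') 0)
    {t : ℝ} (ht : 0 < t) :
    letI θ := thetaFill F a₀ ε₂₉; letI := θ.instVβ₁; letI := θ.instVβ₂
    ∀ᶠ B in 𝓝 (0 : recordW F a₀ ε₂₉ k K), PlaqSmall t (portVkAx F a₀ ε₂₉ k K B) := by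
  letI θ := thetaFill F a₀ ε₂₉; letI := θ.instVβ₁; letI := θ.instVβ₂
  have hcont := continuousAt_iter_recordBgField F θ hk hP9
  have h0 : Averaging.iter (avOfRecord F 2 K) k (recordBgField F θ k K (0 : recordW F a₀ ε₂₉ k K)) = 1 := by
    rw [recordBgField_zero F θ hk]
    exact B15Claim189UnitTestAtRecord.iter_avOfRecord_one F 2 K k
  have hopen : IsOpen {U : GaugeField (F.P K) k (SU 2) | PlaqSmall t U} := isOpen_plaqSmall t
  have h1 : PlaqSmall t (Averaging.iter (avOfRecord F 2 K) k (recordBgField F θ k K (0 : recordW F a₀ ε₂₉ k K))) := by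
    rw [h0]
    intro p
    rw [B15Chi124DetSets.plaqHol_one, GaugeGroup.dist1_one]
    exact ht
  have hev : ∀ᶠ B in 𝓝 (0 : recordW F a₀ ε₂₉ k K), PlaqSmall t (Averaging.iter (avOfRecord F 2 K) k (recordBgField F θ k K B)) :=
    hcont.preimage_mem_nhds (hopen.mem_nhds h1)
  filter_upwards [hev, eventually_portVkAx_eq_axialize_iter F a₀ ε₂₉ hk hε₁ hTokE] with B hB hax
  rw [hax, N07CritCfgAxOfRecordClauses.plaqSmall_axialize_iff]
  exact hB

/-- ★★ **NEAR `B = 0` EVERY (0.4) LOOP VARIABLE OF `V^{(k)}_{ax}(W_B)` IS WITHIN `α` OF `1`**, for every `α > 0` (loop variables are products of `≤ ((d+2)L)²∕4` plaquettes).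
[cite: Balaban1987RG1, (0.4) p.253, (2.3) p.265; Balaban1985Averaging, (19)–(20) p.21] -/
theorem eventually_loopSmall_portVkAx (a₀ ε₂₉ : ℝ) {k K : ℕ} (hk : k + 1 ≤ (F.P K).m + (F.P K).K) {ε₁ : ℝ} (hε₁ : 0 < ε₁)
    (hTokE : ∀ V : GaugeField (F.P K) (k + 1) (SU 2), PlaqSmall ε₁ V → UkExists F 2 K (k + 1) a₀ V ∧ UniqueUkOrbit F 2 K (k + 1) a₀ V)
    (hP9 : letI θ := thetaFill F a₀ ε₂₉; letI := θ.instVβ₁; letI := θ.instVβ₂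
      AnalyticAt ℝ (fun B : recordW F a₀ ε₂₉ k K => fun (b : PBond (F.P K) 0) (i i' : Fin 2) =>
        ((recordBgField F θ k K B b : SU 2) : Matrix (Fin 2) (Fin 2) ℂ) i i') 0)
    {α : ℝ} (hα : 0 < α) :
    letI θ := thetaFill F a₀ ε₂₉; letI := θ.instVβ₁; letI := θ.instVβ₂
    ∀ᶠ B in 𝓝 (0 : recordW F a₀ ε₂₉ k K), ∀ (c : PBond (F.P K) (k + 1)) (i : Idx (F.P K)), dist1 (loopHol (portVkAx F a₀ ε₂₉ k K B) c i) ≤ α := by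
  letI θ := thetaFill F a₀ ε₂₉; letI := θ.instVβ₁; letI := θ.instVβ₂
  set Cst : ℝ := ((((F.P K).d + 2) * (F.P K).L : ℕ) : ℝ) ^ 2 / 4 with hCst
  have hCpos : 0 < Cst := by
    have hL : (0 : ℝ) < (((F.P K).d + 2) * (F.P K).L : ℕ) := by
      have := (F.P K).L_pos
      positivity
    positivity
  have ht : 0 < α / Cst := div_pos hα hCpos
  filter_upwards [eventually_plaqSmall_portVkAx F a₀ ε₂₉ hk hε₁ hTokE hP9 ht] with B hB c i
  have h := LatticeWordStokes.dist1_loopHol_le ht.le hB c i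
  calc dist1 (loopHol (portVkAx F a₀ ε₂₉ k K B) c i) ≤ Cst * (α / Cst) := h
    _ = α := by field_simp

/-- ★★ **NEAR `B = 0` THE RECORD's BACKGROUND IS INSIDE THE (0.4) GUARD AT EVERY COARSE BOND** (the `hsmall` hypothesis of `recordLQt_mem_lieSU_of_small`, `recordZkkCan_eq_recordZkkLoc_of_small`,
`hasFDerivAt_recordQt_of_small`, discharged on the germ at `B = 0`). [cite: Balaban1987RG1, (0.4) p.253, (2.3) p.265] -/
theorem eventually_small_portVkAx (a₀ ε₂₉ : ℝ) {k K : ℕ} (hk : k + 1 ≤ (F.P K).m + (F.P K).K) {ε₁ : ℝ} (hε₁ : 0 < ε₁)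
    (hTokE : ∀ V : GaugeField (F.P K) (k + 1) (SU 2), PlaqSmall ε₁ V → UkExists F 2 K (k + 1) a₀ V ∧ UniqueUkOrbit F 2 K (k + 1) a₀ V)
    (hP9 : letI θ := thetaFill F a₀ ε₂₉; letI := θ.instVβ₁; letI := θ.instVβ₂
      AnalyticAt ℝ (fun B : recordW F a₀ ε₂₉ k K => fun (b : PBond (F.P K) 0) (i i' : Fin 2) =>
        ((recordBgField F θ k K B b : SU 2) : Matrix (Fin 2) (Fin 2) ℂ) i i') 0) :
    letI θ := thetaFill F a₀ ε₂₉; letI := θ.instVβ₁; letI := θ.instVβ₂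
    ∀ᶠ B in 𝓝 (0 : recordW F a₀ ε₂₉ k K), ∀ c : PBond (F.P K) (k + 1), Small expMeanLogSU (portVkAx F a₀ ε₂₉ k K B) c := by
  letI θ := thetaFill F a₀ ε₂₉; letI := θ.instVβ₁; letI := θ.instVβ₂
  have hδ := ExpMeanLog.deltaSU_pos (n := Fin 2)
  filter_upwards [eventually_loopSmall_portVkAx F a₀ ε₂₉ hk hε₁ hTokE hP9 (half_pos hδ)] with B hB c i
  exact lt_of_le_of_lt (hB c i) (half_lt_self hδ)

/-! ## §3  ★★★ The letter along the path, and the Z-bridge with only positivity displayed -/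

/-- ★★★ **THE LETTER ALONG THE RECORD's PATH**: under the TokE and TokP9-reg shapes (standing range), EVENTUALLY near `B = 0` the `b₀`-block of `LQ̃(V^{(k)}_{ax}(W_B))` is invertible —
`RecordB0BlockInvertible F k K (portVkAx F a₀ ε₂₉ k K B)` (the `hA` hypothesis of `phiLZ_eq_logDet_sum₀` ∕ `phiLZ_eq_resolvent` discharged on the germ at `B = 0`).
[cite: Balaban1987RG1, p.267–268, (2.3) p.265; Balaban1985Variational, Thm 1 p.279, Prop. 9 p.309] -/
theorem eventually_recordB0BlockInvertible_portVkAx (a₀ ε₂₉ : ℝ) {k K : ℕ} (hk : k + 1 ≤ (F.P K).m + (F.P K).K) {ε₁ : ℝ} (hε₁ : 0 < ε₁)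
    (hTokE : ∀ V : GaugeField (F.P K) (k + 1) (SU 2), PlaqSmall ε₁ V → UkExists F 2 K (k + 1) a₀ V ∧ UniqueUkOrbit F 2 K (k + 1) a₀ V)
    (hP9 : letI θ := thetaFill F a₀ ε₂₉; letI := θ.instVβ₁; letI := θ.instVβ₂
      AnalyticAt ℝ (fun B : recordW F a₀ ε₂₉ k K => fun (b : PBond (F.P K) 0) (i i' : Fin 2) =>
        ((recordBgField F θ k K B b : SU 2) : Matrix (Fin 2) (Fin 2) ℂ) i i') 0) :
    letI θ := thetaFill F a₀ ε₂₉; letI := θ.instVβ₁; letI := θ.instVβ₂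
    ∀ᶠ B in 𝓝 (0 : recordW F a₀ ε₂₉ k K), RecordB0BlockInvertible F k K (portVkAx F a₀ ε₂₉ k K B) := by
  letI θ := thetaFill F a₀ ε₂₉; letI := θ.instVβ₁; letI := θ.instVβ₂
  -- a radius `α` in the window of `recordB0BlockInvertible_of_loopSmall`
  set R : ℝ := (((F.P K).L : ℝ) ^ ((F.P K).d - 1))⁻¹ with hR
  have hRpos : 0 < R := by
    have hL : (0 : ℝ) < (F.P K).L := by exact_mod_cast (F.P K).L_pos
    positivity
  set α : ℝ := min (1 / 24) (R / 314) with hαdef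
  have hαpos : 0 < α := lt_min (by norm_num) (by positivity)
  have hα24 : α ≤ 1 / 24 := min_le_left _ _
  have hαL : 157 * α < R := by
    have h1 : α ≤ R / 314 := min_le_right _ _
    linarith
  filter_upwards [eventually_loopSmall_portVkAx F a₀ ε₂₉ hk hε₁ hTokE hP9 hαpos] with B hB
  exact recordB0BlockInvertible_of_loopSmall F k K hk _ hB hα24 hαL

/-- ★★ **THE Z-BRIDGE ALONG THE PATH WITH ONLY POSITIVITY DISPLAYED**: under the two token shapes, eventually near `B = 0`, for every `εbg` and every `hopLin`,
`PosDef (recordPreckLoc … (portVkAx … B) hopLin) → recordZkkCan … = recordZkkLoc …` (`recordZkkCan_eq_recordZkkLoc_of_small` with its `hsmall` and `hA` discharged by §2–§3).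
[cite: Balaban1987RG1, (1.4) p.260, p.267–268, (2.11)–(2.12) p.267–268] -/
theorem eventually_recordZkkCan_eq_recordZkkLoc_portVkAx (a₀ ε₂₉ : ℝ) {k K : ℕ} (hk : k + 1 ≤ (F.P K).m + (F.P K).K) {ε₁ : ℝ} (hε₁ : 0 < ε₁)
    (hTokE : ∀ V : GaugeField (F.P K) (k + 1) (SU 2), PlaqSmall ε₁ V → UkExists F 2 K (k + 1) a₀ V ∧ UniqueUkOrbit F 2 K (k + 1) a₀ V)
    (hP9 : letI θ := thetaFill F a₀ ε₂₉; letI := θ.instVβ₁; letI := θ.instVβ₂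
      AnalyticAt ℝ (fun B : recordW F a₀ ε₂₉ k K => fun (b : PBond (F.P K) 0) (i i' : Fin 2) =>
        ((recordBgField F θ k K B b : SU 2) : Matrix (Fin 2) (Fin 2) ℂ) i i') 0) (εbg : ℝ) :
    letI θ := thetaFill F a₀ ε₂₉; letI := θ.instVβ₁; letI := θ.instVβ₂
    ∀ᶠ B in 𝓝 (0 : recordW F a₀ ε₂₉ k K), ∀ hopLin : (PBond (F.P K) (k + 1) → MatA 2) →ₗ[ℝ] (FluctIdx F k K → ℝ),
      (recordPreckLoc F k K εbg (portVkAx F a₀ ε₂₉ k K B) hopLin).PosDef →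
        recordZkkCan F k K εbg (portVkAx F a₀ ε₂₉ k K B) hopLin = recordZkkLoc F k K εbg (portVkAx F a₀ ε₂₉ k K B) hopLin := by
  letI θ := thetaFill F a₀ ε₂₉; letI := θ.instVβ₁; letI := θ.instVβ₂
  filter_upwards [eventually_small_portVkAx F a₀ ε₂₉ hk hε₁ hTokE hP9, eventually_recordB0BlockInvertible_portVkAx F a₀ ε₂₉ hk hε₁ hTokE hP9] with B hs hA hopLin hP
  exact recordZkkCan_eq_recordZkkLoc_of_small F k K hk εbg _ hopLin hs hA hP

end Summit.QuantumFields.YangMills.Theorems.BalabanUVNodesPortS1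

end
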